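import Mathlib.Geometry.Manifold.VectorBundle.LocalFrame
import Mathlib.AlgebraicGeometry.Modules.Sheaf
import Literature.NumberTheory.Transcendental.AnalytificationProofs
import Literature.AlgebraicGeometry.HodgeTheory.RationalHodgeClasses
import HarnessLib

/-!
# Analytification of algebraic vector bundles (GAGA) and algebraizable holomorphic bundles

Family `hodge`, layer `Literature/AlgebraicGeometry/HodgeTheory`. Consumer: route
`Summits/HodgeConjecture/HodgeConjecture/Theses/AffinePartDecay.lean` (items `stmt-HodgeConjecture-2124`,
`-2120`, `-2121`: "the Grauert holomorphic bundle on the Stein manifold `U^an = (X ∖ H)^an` is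
*algebraic*", Serre GAGA + Grauert's Oka principle).

Serre (GAGA §3 n°9, Déf. 2): for an algebraic sheaf `F` on `X`, the *analytic sheaf associated to
`F`* is `F^h := F' ⊗_{𝒪'} 𝓗` on `X^h`, where `F'`, `𝒪'` are `F`, `𝒪_X` re-topologised along the
continuous map `X^h → X` and `𝓗 = 𝒪_{X^h}`; it comes with a canonical `𝒪'`-linear map
`α : F' → F^h`, and every `𝒪`-linear `φ : F → G` extends to `φ^h : F^h → G^h`. For `F` locally free
of rank `r` (a vector bundle, FAC n°41), `F^h` is locally free of rank `r` over `𝓗`, i.e. the sheaf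
of holomorphic sections of a holomorphic vector bundle `E^h` on `X^h` (GAGA §4 n°20: "tout espace
fibré algébrique `E` définit un espace fibré analytique `E^h`"), whose transition functions are the
algebraic transition functions of `F` read as holomorphic functions on `X^h`. GAGA §4 n°20 Prop. 18:
for `X` projective, every holomorphic vector bundle on `X^h` is (uniquely, Prop. 16) of the form
`E^h` — it is *algebraic*. On a non-proper `X` (e.g. the affine `U = X ∖ H` of the route) this is a
genuine condition on a holomorphic bundle, and the route's reading of the Hodge conjecture is that a
specific holomorphic bundle on `U^an` (Grauert's) satisfies it.

This file makes these notions precise over the tree's analytification layer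
(`Literature.NumberTheory.Transcendental.IsAnalytification`, `HodgeTheory.HodgeModel`: a complex
manifold `N` with a map `ψ : N → X(ℂ)`) and Mathlib's vector bundles
(`FiberBundle` / `VectorBundle ℂ` / `ContMDiffVectorBundle ω … 𝓘(ℂ, E)`), with ONLY real
definitions and proved lemmas (no named facts: cone hygiene for the consuming routes):

* `IsSectionFrame F U s`: the sections `s₁, …, s_r ∈ Γ(F, U)` of an `𝒪_X`-module `F` trivialise
  `F` over the open `U`: over every open `V ≤ U` their restrictions form a basis of the
  `Γ(X, V)`-module `Γ(F, V)` (equivalently `𝒪_U^r ≅ F|_U`, a local frame; Stacks 01C6/01C9).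
  `IsFinLocallyFreeOn F U`: `U` is covered by opens carrying such finite frames, i.e. `F|_U` is a
  vector bundle (finite locally free). Stated on sections, and relative to an OPEN `U` — vector
  bundles on `X ∖ H` need not extend to vector bundles on `X` — which is why the global
  `Literature.AlgebraicGeometry.Motives.IsVectorBundle` (= Mathlib `IsLocallyFree ∧ IsFiniteType`
  on all of `X`) is not used here.
* `IsAnalytifiedVectorBundle I Fib ψ F α`: the GAGA COMPARISON PREDICATE. Given `ψ : N → X(ℂ)`
  (intended: an analytification of `X`, or of an open `U ⊆ X`, e.g. a Hodge model or an open subset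
  of one), an `𝒪_X`-module `F` and a topological/holomorphic vector bundle `V` on `N` with model fibre
  `Fib`, a family of maps `α U : Γ(F, U) → (sections of V)` IS Serre's canonical `α : F → ψ_* 𝓥`
  identifying `V` with `F^h`: it is additive, `𝒪_X`-linear (`α(f • s) = (f ∘ ψ) • α(s)`), compatible
  with restriction, takes values in HOLOMORPHIC sections (`MDifferentiableOn` into the total space,
  the tree's and Mathlib's convention for holomorphy, cf. `IsAnalytification`,
  `Mathlib.Geometry.Manifold.Complex`), and maps algebraic frames of `F` over `U` to pointwise bases
  of the fibres `V x`, `ψ x ∈ U(ℂ)` (so the holomorphic trivialisations of `V` induced by algebraic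
  frames have the algebraic transition functions `g_{ij} ∘ ψ`: `(V, α) ≅ (F^h, α_can)`, and
  conversely `F^h` with Serre's `α` satisfies the predicate). The values of `α U s` off
  `ψ⁻¹(U(ℂ))` are junk and unconstrained.
* `AnalytifiedVectorBundle I Fib ψ F`: the DATA of an analytification `F^an` of `F` along `ψ`
  (a holomorphic = `C^ω` Mathlib vector bundle on `N` + comparison maps + the predicate);
  `HodgeModel.analytifiedVectorBundle`: a chosen one over a Hodge model, from an existence witness
  (existence for `X` smooth and `F` a vector bundle is GAGA §3 n°9 + §4 n°20; it is a theorem to be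
  vendored separately, never a field). `IsAnalytifiedHom`: `Φ = u^an` for `u : F ⟶ G` (GAGA
  functoriality `φ ↦ φ^h`), with uniqueness `IsAnalytifiedHom.eq_of_isFinLocallyFreeOn` proved.
* `IsAlgebraizable I Fib ψ V`: the holomorphic bundle `V` on `N` is ALGEBRAIC: `V ≅ (F|_U)^an` for
  some open `U ⊆ X` with `ψ(N) ⊆ U(ℂ)` and some `𝒪_X`-module `F` finite locally free on `U`
  (GAGA §4 n°20, "provient d'un fibré algébrique"). Iso-invariance is built in (compose `α` with the
  isomorphism), so no separate notion of bundle isomorphism is needed. Specialisations to Hodge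
  models: `HodgeModel.analyticOpen U = U^an ⊆ X^an`, `HodgeModel.IsAlgebraizable`,
  `HodgeModel.IsAlgebraizableOn`.
* PROVED EXAMPLE (`𝒪^h = 𝓗`, GAGA §3 n°9): along any analytification `φ`, the trivial line
  bundle `M × ℂ` with `f ↦ f ∘ φ` is the analytification of the structure sheaf
  (`isAnalytifiedVectorBundle_structureSheaf`, using the tree's proved
  `IsAnalytification.mdifferentiableOn_evalOrZero_opens_holds`); hence
  `AnalytifiedVectorBundle.structureSheaf`, `isAlgebraizable_trivial`,
  `HodgeModel.nonempty_analytifiedVectorBundle_structureSheaf` — the predicates are inhabited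
  non-trivially (a frame of `𝒪_X` over `U ∋ φ(m)` is one invertible function, forcing rank one).

## Design notes

* The base `N` is any charted space with a model with corners `I` over `ℂ` (Mathlib generality;
  for a Hodge model `I = 𝓘(ℂ, A.model)`); `I` is an explicit argument since it is not determined
  by `N`. Holomorphy of sections is `MDifferentiableOn I (I.prod 𝓘(ℂ, Fib))` of
  `x ↦ TotalSpace.mk' Fib x (α U s x)` (complex differentiability in charts), exactly as regular
  functions are required to be `MDifferentiableOn` in `IsAnalytification`; the bundle carried by an
  `AnalytifiedVectorBundle` datum is `ContMDiffVectorBundle ω` (analytic transition maps, Mathlib's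
  holomorphic bundles). The two conventions agree mathematically (Osgood–Cauchy); no lemma here
  needs the bridge.
* The predicate only needs `[FiberBundle Fib V]` (and vector-space fibres) to be stated; it is
  the intended notion for holomorphic vector bundles `V`
  (`[VectorBundle ℂ Fib V] [ContMDiffVectorBundle ω Fib V I]`, or exponent `1`).
* Junk analysis. `IsAlgebraizable` requires `ψ(N) ⊆ U(ℂ)` and finite local freeness of `F` on `U`:
  without the latter, a sheaf with no local frames near `ψ(N)` (e.g. a skyscraper) would make the
  frame condition vacuous and every bundle "algebraizable" via `α = 0`. With it, every point of `N`
  lies under a frame, the fibre dimension equals the local rank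
  (`IsAnalytifiedVectorBundle.finrank_eq`), and `u^an` is unique
  (`IsAnalytifiedHom.eq_of_isFinLocallyFreeOn`).
* Not here (deliberately): the existence theorem `F ↦ F^an` (GAGA §3 n°9 for `X` smooth; needs the
  holomorphic cocycle `g_{ij} ∘ ψ` packaged as a `VectorBundleCore` plus Osgood), Serre's
  comparison theorems GAGA §3 Thms 1–3 and §4 Prop. 18 (named facts for a separate `…Facts` file),
  coherent (non-locally-free) analytification.

## References

* J.-P. Serre, *Géométrie algébrique et géométrie analytique*, Ann. Inst. Fourier 6 (1956):
  §2 n°5–6 (`X^h`, `𝒪' ⊂ 𝓗`), §3 n°9 Déf. 2 and Prop. 10 (`F^h`, `α`, `φ^h`), §4 n°20 Props. 16, 18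
  (algebraic vs analytic fibre bundles).
* J.-P. Serre, *Faisceaux algébriques cohérents* (FAC), Ann. Math. 61 (1955), n°41 (vector bundles
  ↔ locally free sheaves).
* The Stacks project, Tags 01C6, 01C9 (finite locally free modules).
-/

noncomputable section

open scoped Manifold ContDiff Bundle Topology
open CategoryTheory AlgebraicGeometry Bundle

universe u

namespace Literature.AlgebraicGeometry.HodgeTheory

/-! ### Algebraic side: frames of an `𝒪_X`-module over an open -/

section Algebraic

variable {X : Scheme.{u}}

/-- The sections `s₀, …, s_{r-1} ∈ Γ(F, U)` of the `𝒪_X`-module `F` form a **frame of `F` over the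
open `U`**: over every open `V ≤ U` the restricted sections are a basis of the `Γ(X, V)`-module
`Γ(F, V)` (linearly independent and spanning). Equivalently the morphism `𝒪_U^r ⟶ F|_U` they define
is an isomorphism (an isomorphism of sheaves is an isomorphism on sections over every open), i.e.
`(U, s)` is a local trivialisation of `F` of rank `r` (Stacks 01C6; FAC n°41).
[folklore] -/
def IsSectionFrame (F : X.Modules) (U : X.Opens) {r : ℕ} (s : Fin r → Γ(F, U)) : Prop :=
  ∀ ⦃V : X.Opens⦄ (hV : V ≤ U),
    LinearIndependent Γ(X, V) (fun i ↦ F.presheaf.map (homOfLE hV).op (s i)) ∧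
      ⊤ ≤ Submodule.span Γ(X, V) (Set.range fun i ↦ F.presheaf.map (homOfLE hV).op (s i))

/-- The `𝒪_X`-module `F` is **finite locally free on the open `U`** (its restriction `F|_U` is a
vector bundle): every point of `U` has an open neighbourhood `V ≤ U` over which `F` admits a finite
frame `s : Fin r → Γ(F, V)` (the rank `r` may vary with the connected component). For `U = ⊤` this
is the usual "finite locally free" (Stacks 01C6, Hartshorne II.5), stated on sections.
[folklore] -/
def IsFinLocallyFreeOn (F : X.Modules) (U : X.Opens) : Prop :=
  ∀ x ∈ U, ∃ (V : X.Opens) (r : ℕ) (s : Fin r → Γ(F, V)), x ∈ V ∧ V ≤ U ∧ IsSectionFrame F V s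

/-- Restricting twice is restricting once (functoriality of the presheaf of sections).
[folklore] -/
theorem presheaf_map_map (F : X.Modules) {U V W : X.Opens} (hVU : V ≤ U) (hWV : W ≤ V)
    (t : Γ(F, U)) :
    F.presheaf.map (homOfLE hWV).op (F.presheaf.map (homOfLE hVU).op t) =
      F.presheaf.map (homOfLE (hWV.trans hVU)).op t := by
  have e : F.presheaf.map (homOfLE (hWV.trans hVU)).op =
      F.presheaf.map (homOfLE hVU).op ≫ F.presheaf.map (homOfLE hWV).op := by
    rw [← F.presheaf.map_comp]
    rfl
  rw [e, CategoryTheory.comp_apply]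

/-- Restricting along `le_rfl` is the identity. [folklore] -/
theorem presheaf_map_le_refl (F : X.Modules) {U : X.Opens} (t : Γ(F, U)) :
    F.presheaf.map (homOfLE (le_refl U)).op t = t := by
  have e : F.presheaf.map (homOfLE (le_refl U)).op = 𝟙 _ := by
    rw [← F.presheaf.map_id]
    rfl
  rw [e]
  rfl

variable {F : X.Modules} {U W : X.Opens} {r : ℕ} {s : Fin r → Γ(F, U)}

/-- A frame over `U` restricts to a frame over every smaller open `W ≤ U`.
[folklore] -/
theorem IsSectionFrame.of_le (hs : IsSectionFrame F U s) (hWU : W ≤ U) :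
    IsSectionFrame F W (fun i ↦ F.presheaf.map (homOfLE hWU).op (s i)) := by
  intro V hV
  simp only [presheaf_map_map]
  exact hs (hV.trans hWU)

/-- The frame property over `U` itself: the sections `s i` are a basis of `Γ(F, U)`.
[folklore] -/
theorem IsSectionFrame.self (hs : IsSectionFrame F U s) :
    LinearIndependent Γ(X, U) s ∧ ⊤ ≤ Submodule.span Γ(X, U) (Set.range s) := by
  have h := hs le_rfl
  simp only [presheaf_map_le_refl] at h
  exact h

/-- The basis of `Γ(F, U)` given by a frame over `U`. [folklore] -/
def IsSectionFrame.basis (hs : IsSectionFrame F U s) : Module.Basis (Fin r) Γ(X, U) Γ(F, U) :=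
  Module.Basis.mk hs.self.1 hs.self.2

/-- The basis vectors of `hs.basis` are the frame sections. [folklore] -/
@[simp]
theorem IsSectionFrame.basis_apply (hs : IsSectionFrame F U s) (i : Fin r) : hs.basis i = s i :=
  Module.Basis.mk_apply _ _ i

/-- Finite local freeness passes to smaller opens. [folklore] -/
theorem IsFinLocallyFreeOn.mono (h : IsFinLocallyFreeOn F U) (hWU : W ≤ U) :
    IsFinLocallyFreeOn F W := by
  intro x hx
  obtain ⟨V, r, s, hxV, -, hs⟩ := h x (hWU hx)
  exact ⟨V ⊓ W, r, fun i ↦ F.presheaf.map (homOfLE inf_le_left).op (s i), ⟨hxV, hx⟩, inf_le_right,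
    hs.of_le inf_le_left⟩

end Algebraic

/-! ### GAGA functoriality predicate: `u ↦ u^an` (fibrewise, no topology needed) -/

section Hom

open Motives (SchemeOver ComplexPoints AlgPoints)

variable {N : Type*} {X : SchemeOver ℂ} {F G K : X.left.Modules}
  {V : N → Type*} [∀ x, AddCommGroup (V x)] [∀ x, Module ℂ (V x)]
  {W : N → Type*} [∀ x, AddCommGroup (W x)] [∀ x, Module ℂ (W x)]
  {Q : N → Type*} [∀ x, AddCommGroup (Q x)] [∀ x, Module ℂ (Q x)]

/-- **GAGA functoriality predicate**: the fibrewise linear map `Φ : V → W` **is `u^an`** for the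
`𝒪_X`-linear `u : F ⟶ G`, relative to comparison maps `α` (for `F`, `V`) and `β` (for `G`, `W`):
`Φ (α(s)) = β (u s)` over `ψ⁻¹(U(ℂ))` for every section `s ∈ Γ(F, U)` (Serre: `φ ↦ φ^h` by
extension of scalars, GAGA §3 n°9). When `F` is finite locally free, `Φ` is determined by this
(`IsAnalytifiedHom.eq_of_isFinLocallyFreeOn`). [cite: SerreGAGA1956, §3 n°9 Déf. 2] -/
def IsAnalytifiedHom (ψ : N → ComplexPoints X) (u : F ⟶ G)
    (α : ∀ U : X.left.Opens, Γ(F, U) → ∀ x : N, V x)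
    (β : ∀ U : X.left.Opens, Γ(G, U) → ∀ x : N, W x) (Φ : ∀ x : N, V x →ₗ[ℂ] W x) : Prop :=
  ∀ (U : X.left.Opens) (s : Γ(F, U)) (x : N), (ψ x).pt ∈ U → Φ x (α U s x) = β U (u.app U s) x

/-- The identity is `(𝟙 F)^an`. [cite: SerreGAGA1956, §3 n°9 Déf. 2] -/
theorem isAnalytifiedHom_id (ψ : N → ComplexPoints X)
    (α : ∀ U : X.left.Opens, Γ(F, U) → ∀ x : N, V x) :
    IsAnalytifiedHom ψ (𝟙 F) α α (fun _ ↦ LinearMap.id) :=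
  fun _ _ _ _ ↦ rfl

/-- `(u ≫ v)^an = v^an ∘ u^an` (functoriality of `φ ↦ φ^h`). [cite: SerreGAGA1956, §3 n°9 Déf. 2] -/
theorem IsAnalytifiedHom.comp {ψ : N → ComplexPoints X} {u : F ⟶ G} {v : G ⟶ K}
    {α : ∀ U : X.left.Opens, Γ(F, U) → ∀ x : N, V x}
    {β : ∀ U : X.left.Opens, Γ(G, U) → ∀ x : N, W x}
    {γ : ∀ U : X.left.Opens, Γ(K, U) → ∀ x : N, Q x}
    {Φ : ∀ x : N, V x →ₗ[ℂ] W x} {Ψ : ∀ x : N, W x →ₗ[ℂ] Q x}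
    (hΦ : IsAnalytifiedHom ψ u α β Φ) (hΨ : IsAnalytifiedHom ψ v β γ Ψ) :
    IsAnalytifiedHom ψ (u ≫ v) α γ (fun x ↦ Ψ x ∘ₗ Φ x) := by
  intro U s x hx
  rw [LinearMap.comp_apply, hΦ U s x hx, hΨ U _ x hx, Scheme.Modules.Hom.comp_app,
    CategoryTheory.comp_apply]

end Hom

/-! ### Analytic side: the GAGA comparison predicate -/

section Analytic

open Motives (SchemeOver ComplexPoints AlgPoints)

variable {EN : Type*} [NormedAddCommGroup EN] [NormedSpace ℂ EN] {HN : Type*} [TopologicalSpace HN]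
  (I : ModelWithCorners ℂ EN HN) {N : Type*} [TopologicalSpace N] [ChartedSpace HN N]
  {X : SchemeOver ℂ}
  (Fib : Type*) [NormedAddCommGroup Fib] [NormedSpace ℂ Fib]

section Predicate

variable {V : N → Type*} [TopologicalSpace (TotalSpace Fib V)] [∀ x, AddCommGroup (V x)]
  [∀ x, Module ℂ (V x)] [∀ x, TopologicalSpace (V x)] [FiberBundle Fib V]

/-- **GAGA comparison predicate**: the vector bundle `V` on the complex manifold `N` (charts
modelled by `I`), lying over the `ℂ`-scheme `X` via `ψ : N → X(ℂ)` (an analytification of `X` or of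
an open of `X`), together with the maps `α U : Γ(F, U) → (x ↦ V x)`, **is the analytification
`F^an` of the `𝒪_X`-module `F` with its canonical comparison map** `α : F → ψ_* 𝓥` (Serre's
`α : F' → F^h = F' ⊗_{𝒪'} 𝓗`, GAGA §3 n°9 Déf. 2): `α` is additive and `𝒪_X`-linear (a regular
function acts on `V` through its values along `ψ`), compatible with restrictions, valued in
holomorphic sections over `ψ⁻¹(U(ℂ))` (complex-differentiable maps into the total space), and sends
every algebraic frame of `F` over `U` to a pointwise basis of the fibres `V x`, `ψ x ∈ U(ℂ)` — so
the holomorphic trivialisations of `V` induced by algebraic frames have the algebraic transition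
functions read through `ψ`, which is `F^h` for locally free `F` (GAGA §4 n°20). Values of `α U s`
off `ψ⁻¹(U(ℂ))` are unconstrained junk. Intended for holomorphic `V`
(`[ContMDiffVectorBundle ω Fib V I]`). [cite: SerreGAGA1956, §3 n°9 Déf. 2] -/
structure IsAnalytifiedVectorBundle (ψ : N → ComplexPoints X) (F : X.left.Modules)
    (α : ∀ U : X.left.Opens, Γ(F, U) → ∀ x : N, V x) : Prop where
  /-- `α` is additive on `ψ⁻¹(U(ℂ))`. -/
  map_add : ∀ (U : X.left.Opens) (s t : Γ(F, U)) (x : N), (ψ x).pt ∈ U →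
    α U (s + t) x = α U s x + α U t x
  /-- `α` is `𝒪_X`-linear: `α(f • s)(x) = f(ψ x) • α(s)(x)`. -/
  map_smul : ∀ (U : X.left.Opens) (f : Γ(X.left, U)) (s : Γ(F, U)) (x : N) (hx : (ψ x).pt ∈ U),
    α U (f • s) x = (ψ x).eval U hx f • α U s x
  /-- `α` commutes with restriction to smaller opens. -/
  map_res : ∀ (U W : X.left.Opens) (hWU : W ≤ U) (s : Γ(F, U)) (x : N), (ψ x).pt ∈ W →
    α W (F.presheaf.map (homOfLE hWU).op s) x = α U s x
  /-- `α U s` is a holomorphic section of `V` over `ψ⁻¹(U(ℂ))`. -/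
  mdifferentiableOn : ∀ (U : X.left.Opens) (s : Γ(F, U)),
    MDifferentiableOn I (I.prod 𝓘(ℂ, Fib))
      (fun x ↦ TotalSpace.mk' Fib x (α U s x)) (ψ ⁻¹' {P | P.pt ∈ U})
  /-- Algebraic frames of `F` over `U` are pointwise bases of the fibres over `ψ⁻¹(U(ℂ))`. -/
  frame : ∀ (U : X.left.Opens) (r : ℕ) (s : Fin r → Γ(F, U)), IsSectionFrame F U s →
    ∀ x : N, (ψ x).pt ∈ U →
      LinearIndependent ℂ (fun i ↦ α U (s i) x) ∧
        ⊤ ≤ Submodule.span ℂ (Set.range fun i ↦ α U (s i) x)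

variable {I Fib}
variable {ψ : N → ComplexPoints X} {F G : X.left.Modules}
  {α : ∀ U : X.left.Opens, Γ(F, U) → ∀ x : N, V x}

namespace IsAnalytifiedVectorBundle

/-- `α U 0 = 0` on `ψ⁻¹(U(ℂ))`. [cite: SerreGAGA1956, §3 n°9 Déf. 2] -/
theorem map_zero (h : IsAnalytifiedVectorBundle I Fib ψ F α) (U : X.left.Opens) (x : N)
    (hx : (ψ x).pt ∈ U) : α U 0 x = 0 := by
  have := h.map_add U 0 0 x hx
  rw [add_zero] at this
  exact left_eq_add.mp this

/-- `α` is compatible with negation on `ψ⁻¹(U(ℂ))`. [cite: SerreGAGA1956, §3 n°9 Déf. 2] -/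
theorem map_neg (h : IsAnalytifiedVectorBundle I Fib ψ F α) (U : X.left.Opens) (s : Γ(F, U))
    (x : N) (hx : (ψ x).pt ∈ U) : α U (-s) x = -α U s x := by
  have := h.map_add U (-s) s x hx
  rw [neg_add_cancel, h.map_zero U x hx] at this
  exact (neg_eq_of_add_eq_zero_left this.symm).symm

/-- The comparison map at a point of `ψ⁻¹(U(ℂ))`, as an additive homomorphism
`Γ(F, U) →+ V x`. [cite: SerreGAGA1956, §3 n°9 Déf. 2] -/
def evalAddMonoidHom (h : IsAnalytifiedVectorBundle I Fib ψ F α) (U : X.left.Opens) (x : N)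
    (hx : (ψ x).pt ∈ U) : Γ(F, U) →+ V x where
  toFun s := α U s x
  map_zero' := h.map_zero U x hx
  map_add' s t := h.map_add U s t x hx

/-- `h.evalAddMonoidHom U x hx s = α U s x`. [cite: SerreGAGA1956, §3 n°9 Déf. 2] -/
@[simp]
theorem evalAddMonoidHom_apply (h : IsAnalytifiedVectorBundle I Fib ψ F α) (U : X.left.Opens)
    (x : N) (hx : (ψ x).pt ∈ U) (s : Γ(F, U)) : h.evalAddMonoidHom U x hx s = α U s x :=
  rfl

/-- The comparison sections are continuous on `ψ⁻¹(U(ℂ))` (holomorphic maps are continuous).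
[cite: SerreGAGA1956, §3 n°9 Déf. 2] -/
theorem continuousOn (h : IsAnalytifiedVectorBundle I Fib ψ F α) (U : X.left.Opens)
    (s : Γ(F, U)) :
    ContinuousOn (fun x ↦ TotalSpace.mk' Fib x (α U s x)) (ψ ⁻¹' {P | P.pt ∈ U}) :=
  (h.mdifferentiableOn U s).continuousOn

/-- The basis of the fibre `V x` given by an algebraic frame of `F` over `U ∋ ψ x`.
[cite: SerreGAGA1956, §4 n°20] -/
def basisAt (h : IsAnalytifiedVectorBundle I Fib ψ F α) {U : X.left.Opens} {r : ℕ}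
    {s : Fin r → Γ(F, U)} (hs : IsSectionFrame F U s) {x : N} (hx : (ψ x).pt ∈ U) :
    Module.Basis (Fin r) ℂ (V x) :=
  Module.Basis.mk (h.frame U r s hs x hx).1 (h.frame U r s hs x hx).2

/-- The vectors of `h.basisAt hs hx` are the values of the frame sections.
[cite: SerreGAGA1956, §4 n°20] -/
@[simp]
theorem basisAt_apply (h : IsAnalytifiedVectorBundle I Fib ψ F α) {U : X.left.Opens} {r : ℕ}
    {s : Fin r → Γ(F, U)} (hs : IsSectionFrame F U s) {x : N} (hx : (ψ x).pt ∈ U) (i : Fin r) :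
    h.basisAt hs hx i = α U (s i) x :=
  Module.Basis.mk_apply _ _ i

/-- **Rank = fibre dimension**: if `F` has a frame of size `r` over `U ∋ ψ x`, then
`dim_ℂ Fib = dim_ℂ (V x) = r` (GAGA: `F^h` is locally free of the same rank as `F`).
[cite: SerreGAGA1956, §4 n°20] -/
theorem finrank_eq [VectorBundle ℂ Fib V] (h : IsAnalytifiedVectorBundle I Fib ψ F α)
    {U : X.left.Opens} {r : ℕ} {s : Fin r → Γ(F, U)} (hs : IsSectionFrame F U s) {x : N}
    (hx : (ψ x).pt ∈ U) : Module.finrank ℂ Fib = r := by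
  have e : V x ≃ₗ[ℂ] Fib :=
    (trivializationAt Fib V x).linearEquivAt ℂ x (FiberBundle.mem_baseSet_trivializationAt' x)
  rw [← e.finrank_eq, Module.finrank_eq_card_basis (h.basisAt hs hx), Fintype.card_fin]

/-- The comparison sections of an algebraic frame form a continuous (`C⁰`) local frame of `V` over
`ψ⁻¹(U(ℂ))` in the sense of Mathlib's `IsLocalFrameOn`. [cite: SerreGAGA1956, §4 n°20] -/
theorem isLocalFrameOn (h : IsAnalytifiedVectorBundle I Fib ψ F α) {U : X.left.Opens} {r : ℕ}
    {s : Fin r → Γ(F, U)} (hs : IsSectionFrame F U s) :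
    IsLocalFrameOn I Fib 0 (fun i x ↦ α U (s i) x) (ψ ⁻¹' {P | P.pt ∈ U}) where
  linearIndependent hx := (h.frame U r s hs _ hx).1
  generating hx := (h.frame U r s hs _ hx).2
  contMDiffOn i := contMDiffOn_zero_iff.mpr (h.continuousOn U (s i))

end IsAnalytifiedVectorBundle

variable {W : N → Type*} [∀ x, AddCommGroup (W x)] [∀ x, Module ℂ (W x)]
  {u : F ⟶ G} {β : ∀ U : X.left.Opens, Γ(G, U) → ∀ x : N, W x} {Φ Φ' : ∀ x : N, V x →ₗ[ℂ] W x}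

/-- **Uniqueness of `u^an`**: two fibrewise linear maps which are both `u^an` agree at every
point lying over an open on which `F` is finite locally free (they agree on the values of a local
frame, which span the fibre). [cite: SerreGAGA1956, §3 n°9 Déf. 2] -/
theorem IsAnalytifiedHom.eq_of_isFinLocallyFreeOn (hα : IsAnalytifiedVectorBundle I Fib ψ F α)
    {U : X.left.Opens} (hF : IsFinLocallyFreeOn F U) (h₁ : IsAnalytifiedHom ψ u α β Φ)
    (h₂ : IsAnalytifiedHom ψ u α β Φ') {x : N} (hx : (ψ x).pt ∈ U) : Φ x = Φ' x := by
  obtain ⟨U', r, s, hxU', -, hs⟩ := hF _ hx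
  refine Module.Basis.ext (hα.basisAt hs hxU') fun i ↦ ?_
  rw [hα.basisAt_apply, h₁ U' (s i) x hxU', h₂ U' (s i) x hxU']

end Predicate

/-! ### Analytification data and algebraizable bundles -/

/-- **An analytification `F^an` of the `𝒪_X`-module `F` along `ψ : N → X(ℂ)`** (DATA): a
holomorphic vector bundle on the complex manifold `N` in Mathlib's sense (fibres `bundle x`, model
fibre `Fib`, analytic transition maps `ContMDiffVectorBundle ω`) together with GAGA comparison
maps `an U : Γ(F, U) → (x ↦ bundle x)`, `s ↦ s^an`, satisfying `IsAnalytifiedVectorBundle`.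
For `X` smooth, `ψ` an analytification and `F` a vector bundle of rank `dim Fib` such a datum
exists (GAGA §3 n°9 with §4 n°20) and any two are uniquely isomorphic
(`IsAnalytifiedHom.eq_of_isFinLocallyFreeOn`); existence is a theorem to be supplied, never a
field. [cite: SerreGAGA1956, §3 n°9 Déf. 2] -/
structure AnalytifiedVectorBundle (ψ : N → ComplexPoints X) (F : X.left.Modules) where
  /-- The fibres `x ↦ F^an_x` of the analytified bundle. -/
  bundle : N → Type
  /-- Each fibre is an additive group … -/
  [addCommGroup : ∀ x, AddCommGroup (bundle x)]
  /-- … and a complex vector space … -/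
  [module : ∀ x, Module ℂ (bundle x)]
  /-- … with a topology. -/
  [topologicalSpaceFiber : ∀ x, TopologicalSpace (bundle x)]
  /-- The topology of the total space. -/
  [topologicalSpace : TopologicalSpace (TotalSpace Fib bundle)]
  /-- Local triviality. -/
  [fiberBundle : FiberBundle Fib bundle]
  /-- Fibrewise linear local trivialisations. -/
  [vectorBundle : VectorBundle ℂ Fib bundle]
  /-- The bundle is holomorphic (analytic transition maps). -/
  [contMDiffVectorBundle : ContMDiffVectorBundle ω Fib bundle I]
  /-- The GAGA comparison maps `s ↦ s^an`. -/
  an : ∀ U : X.left.Opens, Γ(F, U) → ∀ x : N, bundle x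
  /-- `(bundle, an)` is the analytification of `F` along `ψ`. -/
  isAnalytifiedVectorBundle : IsAnalytifiedVectorBundle I Fib ψ F an

namespace AnalytifiedVectorBundle

attribute [instance] addCommGroup module topologicalSpaceFiber topologicalSpace fiberBundle
  vectorBundle contMDiffVectorBundle

end AnalytifiedVectorBundle

/-- **The holomorphic vector bundle `V` on `N` is algebraizable (algebraic)** relative to
`ψ : N → X(ℂ)`: there are an open `U ⊆ X` with `ψ(N) ⊆ U(ℂ)`, an `𝒪_X`-module `F` which is finite
locally free on `U` (an algebraic vector bundle on `U`) and comparison maps `α` making `(V, α)` the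
analytification of `F` — i.e. `V ≅ (F|_U)^an` as holomorphic bundles ("`V` provient d'un espace
fibré algébrique"). For `X` projective and `N = X^an` every holomorphic vector bundle is
algebraizable (GAGA §4 n°20 Prop. 18); on a non-proper `U` (e.g. an affine `X ∖ H`) it is a genuine
condition. [cite: SerreGAGA1956, §4 n°20 Prop. 18] -/
def IsAlgebraizable (ψ : N → ComplexPoints X) (V : N → Type*) [TopologicalSpace (TotalSpace Fib V)]
    [∀ x, AddCommGroup (V x)] [∀ x, Module ℂ (V x)] [∀ x, TopologicalSpace (V x)]
    [FiberBundle Fib V] : Prop :=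
  ∃ (U : X.left.Opens) (F : X.left.Modules), (∀ x : N, (ψ x).pt ∈ U) ∧ IsFinLocallyFreeOn F U ∧
    ∃ α : ∀ W : X.left.Opens, Γ(F, W) → ∀ x : N, V x, IsAnalytifiedVectorBundle I Fib ψ F α

variable {I Fib} {ψ : N → ComplexPoints X} {F : X.left.Modules}

/-- An analytification datum of a module which is finite locally free on an open containing the
image of `ψ` exhibits its bundle as algebraizable. [cite: SerreGAGA1956, §4 n°20] -/
theorem AnalytifiedVectorBundle.isAlgebraizable (𝓕 : AnalytifiedVectorBundle I Fib ψ F)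
    {U : X.left.Opens} (hU : ∀ x : N, (ψ x).pt ∈ U) (hF : IsFinLocallyFreeOn F U) :
    IsAlgebraizable I Fib ψ 𝓕.bundle :=
  ⟨U, F, hU, hF, 𝓕.an, 𝓕.isAnalytifiedVectorBundle⟩

end Analytic

/-! ### The structure sheaf: `𝒪_X^an` is the trivial line bundle (GAGA §3 n°9: `𝒪^h = 𝓗`) -/

section StructureSheaf

open Motives (SchemeOver ComplexPoints AlgPoints)

/-- The structure sheaf `𝒪_X` as a module over itself (Mathlib `SheafOfModules.unit`); its
sections over `U` are the regular functions `Γ(X, U)`. [folklore] -/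
abbrev structureSheafModule (Y : Scheme.{u}) : Y.Modules :=
  SheafOfModules.unit Y.ringCatSheaf

/-- A regular function `f ∈ Γ(X, U)` as a section of the `𝒪_X`-module `𝒪_X` (the identity map,
recorded to mediate between the ring and the module structure on the same sections). [folklore] -/
abbrev structureSheafModule.ofFun {Y : Scheme.{u}} {U : Y.Opens} (f : Γ(Y, U)) :
    Γ(structureSheafModule Y, U) :=
  f

/-- A section of the `𝒪_X`-module `𝒪_X` as a regular function (the identity map). [folklore] -/
abbrev structureSheafModule.toFun {Y : Scheme.{u}} {U : Y.Opens}
    (s : Γ(structureSheafModule Y, U)) : Γ(Y, U) :=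
  s

/-- The constant section `1` is a frame of `𝒪_X` over every open: `𝒪_X` is free of rank one
on itself. [folklore] -/
theorem isSectionFrame_structureSheaf_one {Y : Scheme.{u}} (U : Y.Opens) :
    IsSectionFrame (structureSheafModule Y) U
      (fun _ : Fin 1 ↦ structureSheafModule.ofFun (1 : Γ(Y, U))) := by
  intro V hV
  have e : (fun _ : Fin 1 ↦ (structureSheafModule Y).presheaf.map (homOfLE hV).op
      (structureSheafModule.ofFun (1 : Γ(Y, U)))) =
        fun _ : Fin 1 ↦ structureSheafModule.ofFun (1 : Γ(Y, V)) := by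
    funext i
    show Y.presheaf.map (homOfLE hV).op (1 : Γ(Y, U)) = (1 : Γ(Y, V))
    exact map_one _
  rw [e]
  refine ⟨Fintype.linearIndependent_iff.mpr fun g hg i ↦ ?_, fun f _ ↦ ?_⟩
  · have h0 : g 0 • structureSheafModule.ofFun (1 : Γ(Y, V)) = 0 := by simpa using hg
    rw [Subsingleton.elim i 0]
    exact (mul_one (g 0)).symm.trans h0
  · rw [Set.range_const, Submodule.mem_span_singleton]
    exact ⟨structureSheafModule.toFun f, mul_one (structureSheafModule.toFun f)⟩

/-- `𝒪_X` is finite locally free (of rank one) on every open. [folklore] -/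
theorem isFinLocallyFreeOn_structureSheaf {Y : Scheme.{u}} (U : Y.Opens) :
    IsFinLocallyFreeOn (structureSheafModule Y) U :=
  fun _ hx ↦ ⟨U, 1, fun _ ↦ structureSheafModule.ofFun 1, hx, le_rfl,
    isSectionFrame_structureSheaf_one U⟩

variable {M : Type*} {X : SchemeOver ℂ}

/-- Serre's comparison map for the structure sheaf along `φ : M → X(ℂ)`: a regular function
`f ∈ Γ(X, U)` goes to the section `m ↦ f(φ m)` of the trivial line bundle `M × ℂ` (junk value `0`
off `φ⁻¹(U(ℂ))`, via `AlgPoints.evalOrZero`). [cite: SerreGAGA1956, §3 n°9 Déf. 2] -/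
def structureSheafComparison (φ : M → ComplexPoints X) (U : X.left.Opens)
    (f : Γ(structureSheafModule X.left, U)) (m : M) : Bundle.Trivial M ℂ m :=
  AlgPoints.evalOrZero U (structureSheafModule.toFun f) (φ m)

/-- `structureSheafComparison φ U f m = f(φ m)` (total evaluation).
[cite: SerreGAGA1956, §3 n°9 Déf. 2] -/
@[simp]
theorem structureSheafComparison_apply (φ : M → ComplexPoints X) (U : X.left.Opens)
    (f : Γ(structureSheafModule X.left, U)) (m : M) :
    structureSheafComparison φ U f m =
      AlgPoints.evalOrZero U (structureSheafModule.toFun f) (φ m) :=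
  rfl

variable {E : Type*} [NormedAddCommGroup E] [NormedSpace ℂ E] [FiniteDimensional ℂ E]
  [TopologicalSpace M] [ChartedSpace E M] {d : ℕ} {φ : M → ComplexPoints X}

/-- **`𝒪_X^an` is the trivial line bundle** (Serre: «on a `𝒪^h = 𝓗`», GAGA §3 n°9, proof of
Prop. 10 c)): along any analytification `φ : M → X(ℂ)`, the trivial bundle `M × ℂ` with the
comparison map `f ↦ f ∘ φ` is the analytification of the structure sheaf. Regular functions pull
back to holomorphic functions (`IsAnalytification.mdifferentiableOn_evalOrZero_opens_holds`), and a
frame of `𝒪_X` over `U ∋ φ(m)` is a single invertible function, whose value at `φ(m)` is a basis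
of `ℂ`. In particular the comparison predicate is inhabited non-trivially.
[cite: SerreGAGA1956, §3 n°9 Prop. 10] -/
theorem isAnalytifiedVectorBundle_structureSheaf
    (hφ : NumberTheory.Transcendental.IsAnalytification E X d φ) :
    IsAnalytifiedVectorBundle 𝓘(ℂ, E) ℂ φ (structureSheafModule X.left)
      (structureSheafComparison φ) where
  map_add U s t x hx := by
    simp only [structureSheafComparison_apply, AlgPoints.evalOrZero_of_mem _ hx]
    exact map_add (X.left.evaluation U (φ x).pt hx ≫ (φ x).resHom).hom
      (structureSheafModule.toFun s) (structureSheafModule.toFun t)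
  map_smul U f s x hx := by
    simp only [structureSheafComparison_apply, AlgPoints.evalOrZero_of_mem _ hx]
    exact map_mul (X.left.evaluation U (φ x).pt hx ≫ (φ x).resHom).hom f
      (structureSheafModule.toFun s)
  map_res U W hWU s x hx :=
    AlgPoints.evalOrZero_map_homOfLE hWU (structureSheafModule.toFun s) hx
  mdifferentiableOn U s x hx := by
    rw [mdifferentiableWithinAt_section]
    simpa using
      NumberTheory.Transcendental.IsAnalytification.mdifferentiableOn_evalOrZero_opens_holds hφ U
        (structureSheafModule.toFun s) x hx
  frame U r s hs x hx := by
    -- the evaluation ring homomorphism `Γ(X, U) → ℂ` at the complex point `φ x`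
    let ev : Γ(X.left, U) →+* ℂ := (X.left.evaluation U (φ x).pt hx ≫ (φ x).resHom).hom
    have hev : ∀ f : Γ(X.left, U), AlgPoints.evalOrZero U f (φ x) = ev f := fun f ↦
      AlgPoints.evalOrZero_of_mem f hx
    haveI : Nontrivial Γ(X.left, U) := ev.domain_nontrivial
    -- a frame of `𝒪_X` over `U` is a basis of `Γ(X, U)` over itself: it has one element …
    obtain ⟨hli, hsp⟩ := hs.self
    have b : Module.Basis (Fin r) Γ(X.left, U) Γ(X.left, U) := Module.Basis.mk hli hsp
    have hr : r = 1 := by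
      have h := Module.finrank_eq_card_basis b
      rw [Module.finrank_self, Fintype.card_fin] at h
      exact h.symm
    subst hr
    -- … which is a unit, so its value at `φ x` is non-zero
    have hunit : IsUnit (structureSheafModule.toFun (s 0)) := by
      have h1 : structureSheafModule.ofFun (1 : Γ(X.left, U)) ∈
          Submodule.span Γ(X.left, U) (Set.range s) := hsp Submodule.mem_top
      rw [Set.range_unique, Submodule.mem_span_singleton] at h1
      obtain ⟨a, ha⟩ := h1
      exact IsUnit.of_mul_eq_one_right a ha
    have hc : AlgPoints.evalOrZero U (structureSheafModule.toFun (s 0)) (φ x) ≠ 0 := by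
      rw [hev]
      exact (hunit.map ev).ne_zero
    refine ⟨linearIndependent_unique_iff.mpr hc, fun z _ ↦ ?_⟩
    rw [Set.range_unique, Submodule.mem_span_singleton]
    exact ⟨z / AlgPoints.evalOrZero U (structureSheafModule.toFun (s 0)) (φ x),
      div_mul_cancel₀ z hc⟩

/-- **`𝒪_X^an` as an analytification datum**: the trivial line bundle `M × ℂ` over an
analytification `φ : M → X(ℂ)` carrying a holomorphic atlas, with Serre's comparison map.
[cite: SerreGAGA1956, §3 n°9 Prop. 10] -/
def AnalytifiedVectorBundle.structureSheaf [IsManifold 𝓘(ℂ, E) ω M]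
    (hφ : NumberTheory.Transcendental.IsAnalytification E X d φ) :
    AnalytifiedVectorBundle 𝓘(ℂ, E) ℂ φ (structureSheafModule X.left) where
  bundle := Bundle.Trivial M ℂ
  an := structureSheafComparison φ
  isAnalytifiedVectorBundle := isAnalytifiedVectorBundle_structureSheaf hφ

/-- The trivial line bundle on an analytification is algebraizable (it is `𝒪_X^an`).
[cite: SerreGAGA1956, §4 n°20] -/
theorem isAlgebraizable_trivial (hφ : NumberTheory.Transcendental.IsAnalytification E X d φ) :
    IsAlgebraizable 𝓘(ℂ, E) ℂ φ (Bundle.Trivial M ℂ) :=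
  ⟨⊤, structureSheafModule X.left, fun _ ↦ trivial, isFinLocallyFreeOn_structureSheaf ⊤,
    structureSheafComparison φ, isAnalytifiedVectorBundle_structureSheaf hφ⟩

end StructureSheaf

/-! ### Specialisation to Hodge models (`N = X^an` or an open `U^an ⊆ X^an`) -/

namespace HodgeModel

open Motives (SchemeOver ComplexPoints AlgPoints)

variable {n : ℕ} {X : SchemeOver ℂ} (A : HodgeModel n X)

/-- The open subset `U^an = φ⁻¹(U(ℂ)) ⊆ X^an` of a Hodge model lying over the Zariski open
`U ⊆ X` (open because `U(ℂ) ⊆ X(ℂ)` is open and the comparison map is continuous); with the induced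
holomorphic atlas it is the analytification of the open subscheme `U` (GAGA §2 n°5).
[cite: SerreGAGA1956, §2 n°5] -/
def analyticOpen (U : X.left.Opens) : TopologicalSpace.Opens A.carrier :=
  ⟨A.toComplexPoints ⁻¹' {P | P.pt ∈ U}, A.isAnalytification.isOpen_preimage U⟩

/-- Membership in `U^an`: `m ∈ U^an ↔ φ(m) ∈ U(ℂ)`. [cite: SerreGAGA1956, §2 n°5] -/
@[simp]
theorem mem_analyticOpen {U : X.left.Opens} {m : A.carrier} :
    m ∈ A.analyticOpen U ↔ (A.toComplexPoints m).pt ∈ U :=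
  Iff.rfl

/-- `⊤^an = X^an`. [cite: SerreGAGA1956, §2 n°5] -/
@[simp]
theorem analyticOpen_top : A.analyticOpen ⊤ = ⊤ :=
  TopologicalSpace.Opens.ext (Set.eq_univ_of_forall fun _ ↦ trivial)

/-- `U ↦ U^an` is monotone. [cite: SerreGAGA1956, §2 n°5] -/
theorem analyticOpen_mono {U U' : X.left.Opens} (h : U ≤ U') :
    A.analyticOpen U ≤ A.analyticOpen U' :=
  fun _ hm ↦ h hm

/-- An analytification `F^an` on the Hodge model `X^an` of an `𝒪_X`-module `F` (data), i.e.
`AnalytifiedVectorBundle` along the comparison map `X^an → X(ℂ)`, holomorphic for the atlas of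
`X^an` modelled on `A.model`. [cite: SerreGAGA1956, §3 n°9 Déf. 2] -/
abbrev AnalytifiedVectorBundle (Fib : Type*) [NormedAddCommGroup Fib] [NormedSpace ℂ Fib]
    (F : X.left.Modules) : Type _ :=
  HodgeTheory.AnalytifiedVectorBundle 𝓘(ℂ, A.model) Fib A.toComplexPoints F

/-- An analytification `(F|_U)^an` on the open `U^an ⊆ X^an` of a Hodge model (data), for an
`𝒪_X`-module `F` (intended: finite locally free on `U`). [cite: SerreGAGA1956, §3 n°9 Déf. 2] -/
abbrev AnalytifiedVectorBundleOn (U : X.left.Opens) (Fib : Type*) [NormedAddCommGroup Fib]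
    [NormedSpace ℂ Fib] (F : X.left.Modules) : Type _ :=
  HodgeTheory.AnalytifiedVectorBundle 𝓘(ℂ, A.model) Fib
    (fun m : A.analyticOpen U ↦ A.toComplexPoints m) F

/-- **The analytified vector bundle `F^an` on `X^an`**: a chosen analytification datum of `F` over
the Hodge model `A`, given a witness that one exists (for `X` smooth and `F` a vector bundle of
rank `dim Fib` this is GAGA §3 n°9 / §4 n°20, a theorem supplied by the caller). Any two choices
are uniquely isomorphic (`IsAnalytifiedHom.eq_of_isFinLocallyFreeOn`), so nothing depends on the
choice up to isomorphism. [cite: SerreGAGA1956, §3 n°9 Déf. 2] -/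
def analytifiedVectorBundle (Fib : Type*) [NormedAddCommGroup Fib] [NormedSpace ℂ Fib]
    (F : X.left.Modules) (h : Nonempty (A.AnalytifiedVectorBundle Fib F)) :
    A.AnalytifiedVectorBundle Fib F :=
  Classical.choice h

/-- **Algebraizability of a holomorphic bundle on `X^an`**: the bundle `V` on the Hodge model is
`F^an` for an algebraic vector bundle `F` on an open of `X` containing every complex point (for `X`
of finite type over `ℂ`: on `X`). [cite: SerreGAGA1956, §4 n°20 Prop. 18] -/
abbrev IsAlgebraizable (Fib : Type*) [NormedAddCommGroup Fib] [NormedSpace ℂ Fib]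
    (V : A.carrier → Type*) [TopologicalSpace (TotalSpace Fib V)] [∀ x, AddCommGroup (V x)]
    [∀ x, Module ℂ (V x)] [∀ x, TopologicalSpace (V x)] [FiberBundle Fib V] : Prop :=
  HodgeTheory.IsAlgebraizable 𝓘(ℂ, A.model) Fib A.toComplexPoints V

/-- **Algebraizability of a holomorphic bundle on an open subset `W ⊆ X^an`** (e.g. `W = U^an`
for `U = X ∖ H` affine, where the Grauert bundle of the route lives): `V ≅ (F|_U)^an|_W` for some
Zariski open `U` with `φ(W) ⊆ U(ℂ)` and some `F` finite locally free on `U`.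
[cite: SerreGAGA1956, §4 n°20 Prop. 18] -/
abbrev IsAlgebraizableOn (W : TopologicalSpace.Opens A.carrier) (Fib : Type*)
    [NormedAddCommGroup Fib] [NormedSpace ℂ Fib] (V : W → Type*)
    [TopologicalSpace (TotalSpace Fib V)] [∀ x, AddCommGroup (V x)] [∀ x, Module ℂ (V x)]
    [∀ x, TopologicalSpace (V x)] [FiberBundle Fib V] : Prop :=
  HodgeTheory.IsAlgebraizable 𝓘(ℂ, A.model) Fib (fun m : W ↦ A.toComplexPoints m) V

/-- The bundle of an analytification datum on `U^an` of a module finite locally free on `U` is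
algebraizable on `U^an`. [cite: SerreGAGA1956, §4 n°20] -/
theorem isAlgebraizableOn_analyticOpen {U : X.left.Opens} {Fib : Type*} [NormedAddCommGroup Fib]
    [NormedSpace ℂ Fib] {F : X.left.Modules} (𝓕 : A.AnalytifiedVectorBundleOn U Fib F)
    (hF : IsFinLocallyFreeOn F U) : A.IsAlgebraizableOn (A.analyticOpen U) Fib 𝓕.bundle :=
  𝓕.isAlgebraizable (fun m ↦ m.2) hF

/-- `𝒪_X^an` on a Hodge model: the trivial line bundle of `X^an` is an analytification datum of
the structure sheaf, so `A.analytifiedVectorBundle ℂ 𝒪_X` is available unconditionally.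
[cite: SerreGAGA1956, §3 n°9 Prop. 10] -/
theorem nonempty_analytifiedVectorBundle_structureSheaf :
    Nonempty (A.AnalytifiedVectorBundle ℂ (structureSheafModule X.left)) :=
  ⟨HodgeTheory.AnalytifiedVectorBundle.structureSheaf A.isAnalytification⟩

/-- The trivial line bundle on a Hodge model `X^an` is algebraizable. [cite: SerreGAGA1956, §4 n°20] -/
theorem isAlgebraizable_trivial : A.IsAlgebraizable ℂ (Bundle.Trivial A.carrier ℂ) :=
  HodgeTheory.isAlgebraizable_trivial A.isAnalytification

end HodgeModel

end Literature.AlgebraicGeometry.HodgeTheory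

end
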